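import Summits.Ventures.HSemireg.WedgeHankelRecurrenceSignatureCoprime
import Summits.Ventures.HSemireg.WedgeHankelRecurrenceSignature

/-!
# Venture HSemireg — HERMITE'S SIGNATURE OVER A PAIRWISE-COPRIME FACTORISATION: for a finite family `(fᵢ)_{i ∈ s}` of PAIRWISE COPRIME monic polynomials of degrees `eᵢ + 1` over a linearly ordered field, any weight `a`
# and any size `t + 1 ≥ deg ∏ fᵢ`, **`sigPos H_t(a(∏fᵢ)′/∏fᵢ) = Σᵢ sigPos H_{eᵢ}(a fᵢ′/fᵢ)`**, the same for `sigNeg`, `sigPos − sigNeg` and `rank` (N136 iterated); and A SPLIT COPRIME FACTOR PEELS OFF: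
# **`sigPos H_t(a(m₁m₂)′/(m₁m₂)) = #{λ ∈ roots m₁ | a(λ) > 0} + sigPos H_{e₂}(a m₂′/m₂)`**, **`sigNeg H_t((m₁m₂)′/(m₁m₂)) = sigNeg H_{e₂}(m₂′/m₂)`** (`m₁` split: all negative squares come from the cofactor)

HONEST FRAMING. Part of the Lean index of the computation cell `pub-hsemireg` (seat p10 gen 34, Sunday typer «UNIFORM-IN-n»).
LINEAR ALGEBRA OF QUADRATIC FORMS AND HANKEL (catalecticant) MATRICES over a field ONLY (Mathlib's `sigPos` ∕ `sigNeg`, `Matrix.toQuadraticForm'`, finite products of polynomials): no variety, no cohomology theory,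
no sheaf, no Ext group and no semiregularity map is constructed here; nothing here says that HC / HC_CM / HC_AV holds; no Literature fact is declared or used.  Custodian versions as in `WedgeHankelSiegelIdeal` (1/3).
SOURCE OF THE ARGUMENT (classical, cited not used): as N136 — Chinese remainder + Sylvester; over a real closed field the statements are the additivity of root counts ∕ Tarski queries over coprime factors
(S. Basu, R. Pollack, M.-F. Roy, *Algorithms in Real Algebraic Geometry*, 2nd ed. 2006, §4.3.2 Thm. 4.57) and of the Cauchy index over partial fractions (F. R. Gantmacher, *The Theory of Matrices* II, Ch. XV).
DEDUP DISCLOSURE (`rg` of the whole tree + Mathlib, 2026-09-01): as N136 (no additivity of Hankel ∕ Hermite ∕ trace-form inertia over coprime factors anywhere); N118 `dualSeq_finset_prod_derivative` is the case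
`a = 1` of `dualSeq_finset_prod_mul_derivative` below; N127 `sigPos_hankelSq_dualSeq_mul_derivative` (split `m`) is USED for the split factor, not restated.
WHAT IS IN THE TREE.  N136 (`WedgeHankelRecurrenceSignatureCoprime`): `dualSeq_mul_mul_derivative_mul`, `sigPos/sigNeg/rank_hankelSq_dualSeq_mul_derivative_of_isCoprime`, `sigPos_sigNeg_hankelSq_dualSeq_derivative_of_isCoprime`,
`sigPos/sigNeg_hankelSq_dualSeq_eq_of_natDegree_le` (size independence).  N127 (`WedgeHankelRecurrenceSignature`): `sigPos/sigNeg_hankelSq_dualSeq_mul_derivative` (split Hermite–Sylvester), `sigPos_hankelSq_dualSeq_derivative`.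
N126: `sigPos/sigNeg_toQuadraticForm'_hankelSq_of_eq_sum` (no node ⇒ both indices `0`).  N132: `rank_hankelSq_eq_sigPos_add_sigNeg`.  N32: `dualSeq_one_zero`.  Mathlib: `Finset.induction_on`, `Finset.prod_insert`,
`Polynomial.monic_prod_of_monic`, `Polynomial.natDegree_prod_of_monic`, `IsCoprime.prod_right`, `Set.Pairwise.mono`, `Finset.single_le_sum`, `Matrix.sum_apply`.
THIS FILE (namespace `Summit.Ventures.HSemireg.Wedge.HankelOuter` continued; CHAINED on N136, PLAIN on N127; 0 definitions; pairwise coprimality as `(s : Set ι).Pairwise fun i j => IsCoprime (f i) (f j)`):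
* §726 FINITE PRODUCTS: `dualSeq_finset_prod_mul_derivative` (`a(∏f)′/∏f = Σ a fᵢ′/fᵢ`, monic factors, no coprimality), `hankelSq_dualSeq_finset_prod_mul_derivative` (the matrices add), `sigPos_sigNeg_hankelSq_zero`,
  `sigPos_sigNeg_hankelSq_dualSeq_one` (empty product), **`sigPos_hankelSq_dualSeq_finset_prod_mul_derivative`** ∕ **`sigNeg_…`** ∕ **`rank_…`** ∕ `sigPos_sub_sigNeg_…` (THE SUMS over pairwise coprime factors,
  by `Finset` induction on N136 with the size-independence lemma for the last factor).
* §727 A SPLIT FACTOR PEELS OFF (`[DecidableEq K]` as in N127): **`sigPos_sigNeg_hankelSq_dualSeq_mul_derivative_of_splits_of_isCoprime`** (weights), **`sigPos_sigNeg_hankelSq_dualSeq_derivative_of_splits_of_isCoprime`**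
  (`a = 1`: `#roots(m₁) + sigPos H(m₂′/m₂)`, `sigNeg = sigNeg H(m₂′/m₂)`), `sigPos_hankelSq_dualSeq_mul_derivative_of_splits_of_splits` (both split: the two root counts — the sanity check against N127 on the product).
CAVEATS.  Monic factors; pairwise coprimality on `s` (not merely `gcd = 1` of the family); `t + 1 ≥ Σ (eᵢ + 1)`; each factor's form at its own size `eᵢ + 1 = deg fᵢ` (any larger size by N136 §723); `rank` over
ordered fields only.  Over a NON-real-closed ordered field a root-free factor can still contribute positive AND zero negative squares (`X² − 2` over `ℚ`: `H_1 = (2 0; 0 4)`), so §727 says nothing about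
root-free cofactors beyond additivity.
Nothing Ext-side.  New names only.
-/

open Module Polynomial
open scoped Matrix Polynomial

namespace Summit.Ventures.HSemireg.Wedge.HankelOuter

open Summit.Ventures.HSemireg.Wedge Summit.Ventures.HSemireg.Wedge.Hankel

variable (K : Type*) [Field K]

/-! ## §726. Finite pairwise-coprime products: the inertia of Hermite's form is the sum over the factors -/

/-- **`dualSeq (∏ᵢ fᵢ) (a·(∏ᵢ fᵢ)′) = Σᵢ dualSeq fᵢ (a·fᵢ′)`** for a finite family of monic polynomials and any weight `a` (`a·(∏ f)′/∏ f = Σ a fᵢ′/fᵢ`; N118 `dualSeq_finset_prod_derivative` is `a = 1`). [this file, §726] -/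
theorem dualSeq_finset_prod_mul_derivative {ι : Type*} [DecidableEq ι] (s : Finset ι) {f : ι → K[X]} (hf : ∀ i ∈ s, (f i).Monic) (a : K[X]) :
    dualSeq K (∏ i ∈ s, f i) (a * derivative (∏ i ∈ s, f i)) = ∑ i ∈ s, dualSeq K (f i) (a * derivative (f i)) := by
  induction s using Finset.induction_on with
  | empty => rw [Finset.prod_empty, Finset.sum_empty, Polynomial.derivative_one, mul_zero, dualSeq_one_zero]
  | insert i s hi ih =>
    rw [Finset.prod_insert hi, Finset.sum_insert hi,
      dualSeq_mul_mul_derivative_mul K (hf i (Finset.mem_insert_self i s)) (Polynomial.monic_prod_of_monic _ _ fun j hj => hf j (Finset.mem_insert_of_mem hj)),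
      ih fun j hj => hf j (Finset.mem_insert_of_mem hj)]

/-- Hence **`H_t(a(∏ f)′/∏ f) = Σᵢ H_t(a fᵢ′/fᵢ)`** as matrices (any `t`, any field, monic factors). [this file, §726] -/
theorem hankelSq_dualSeq_finset_prod_mul_derivative {ι : Type*} [DecidableEq ι] (s : Finset ι) {f : ι → K[X]} (hf : ∀ i ∈ s, (f i).Monic) (a : K[X]) (t : ℕ) :
    hankelSq K t (dualSeq K (∏ i ∈ s, f i) (a * derivative (∏ i ∈ s, f i))) = ∑ i ∈ s, hankelSq K t (dualSeq K (f i) (a * derivative (f i))) := by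
  rw [dualSeq_finset_prod_mul_derivative K s hf a]
  ext j k
  rw [hankelSq, Matrix.of_apply, Finset.sum_apply, Matrix.sum_apply]
  exact Finset.sum_congr rfl fun i _ => by rw [hankelSq, Matrix.of_apply]

section Ordered

variable {K} [LinearOrder K] [IsStrictOrderedRing K]

/-- The zero sequence has the zero Hankel form: `sigPos H_t(0) = 0 = sigNeg H_t(0)` (N126 with no node). [bookkeeping] -/
theorem sigPos_sigNeg_hankelSq_zero (t : ℕ) : sigPos (hankelSq K t (0 : ℕ → K)).toQuadraticForm' = 0 ∧ sigNeg (hankelSq K t (0 : ℕ → K)).toQuadraticForm' = 0 := by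
  have hq : ∀ j, (0 : ℕ → K) j = ∑ c ∈ (∅ : Finset K), (fun _ => (1 : K)) c * c ^ j := fun j => by rw [Finset.sum_empty, Pi.zero_apply]
  have h0 : (∅ : Finset K).card ≤ t + 1 := by rw [Finset.card_empty]; exact Nat.zero_le _
  rw [sigPos_toQuadraticForm'_hankelSq_of_eq_sum ∅ (fun _ => (1 : K)) h0 hq, sigNeg_toQuadraticForm'_hankelSq_of_eq_sum ∅ (fun _ => (1 : K)) h0 hq, Finset.filter_empty, Finset.filter_empty,
    Finset.card_empty]
  exact ⟨rfl, rfl⟩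

/-- The empty product: `dualSeq 1 (a·1′) = 0`, so both indices of `H_t` vanish. [bookkeeping] -/
theorem sigPos_sigNeg_hankelSq_dualSeq_one (t : ℕ) (a : K[X]) :
    sigPos (hankelSq K t (dualSeq K 1 (a * derivative 1))).toQuadraticForm' = 0 ∧ sigNeg (hankelSq K t (dualSeq K 1 (a * derivative 1))).toQuadraticForm' = 0 := by
  rw [Polynomial.derivative_one, mul_zero, dualSeq_one_zero]
  exact sigPos_sigNeg_hankelSq_zero t

/-- **HERMITE'S SIGNATURE OVER A PAIRWISE-COPRIME PRODUCT, positive index: for a finite family `(fᵢ)_{i ∈ s}` of PAIRWISE COPRIME monic polynomials of degrees `eᵢ + 1` over a linearly ordered field, any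
weight `a` and any size `t + 1 ≥ Σᵢ (eᵢ + 1) = deg ∏ fᵢ`: `sigPos H_t(a(∏ᵢ fᵢ)′/∏ᵢ fᵢ) = Σ_{i ∈ s} sigPos H_{eᵢ}(a fᵢ′/fᵢ)`** (N136 §725 iterated; the empty product gives `0 = 0`). [this file, §726] -/
theorem sigPos_hankelSq_dualSeq_finset_prod_mul_derivative {ι : Type*} [DecidableEq ι] (s : Finset ι) {f : ι → K[X]} {e : ι → ℕ} (hf : ∀ i ∈ s, (f i).Monic) (hd : ∀ i ∈ s, (f i).natDegree = e i + 1)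
    (hc : (s : Set ι).Pairwise (fun i j => IsCoprime (f i) (f j))) {t : ℕ} (ht : ∑ i ∈ s, (e i + 1) ≤ t + 1) (a : K[X]) :
    sigPos (hankelSq K t (dualSeq K (∏ i ∈ s, f i) (a * derivative (∏ i ∈ s, f i)))).toQuadraticForm' = ∑ i ∈ s, sigPos (hankelSq K (e i) (dualSeq K (f i) (a * derivative (f i)))).toQuadraticForm' := by
  induction s using Finset.induction_on generalizing t with
  | empty => rw [Finset.prod_empty, Finset.sum_empty]; exact (sigPos_sigNeg_hankelSq_dualSeq_one t a).1
  | insert i s hi ih =>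
    have hfi := hf i (Finset.mem_insert_self i s)
    have hdi := hd i (Finset.mem_insert_self i s)
    have hf' : ∀ j ∈ s, (f j).Monic := fun j hj => hf j (Finset.mem_insert_of_mem hj)
    have hd' : ∀ j ∈ s, (f j).natDegree = e j + 1 := fun j hj => hd j (Finset.mem_insert_of_mem hj)
    have hc' : (s : Set ι).Pairwise (fun i j => IsCoprime (f i) (f j)) := hc.mono (Finset.coe_subset.2 (Finset.subset_insert i s))
    rw [Finset.sum_insert hi] at ht
    rw [Finset.prod_insert hi, Finset.sum_insert hi]
    rcases s.eq_empty_or_nonempty with rfl | hne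
    · rw [Finset.prod_empty, mul_one, Finset.sum_empty, add_zero]
      rw [Finset.sum_empty, add_zero] at ht
      exact sigPos_hankelSq_dualSeq_eq_of_natDegree_le hfi hdi ht _
    · have hm₂ : (∏ j ∈ s, f j).Monic := Polynomial.monic_prod_of_monic _ _ hf'
      have hdeg : (∏ j ∈ s, f j).natDegree = ∑ j ∈ s, (e j + 1) := by
        rw [Polynomial.natDegree_prod_of_monic _ _ hf']; exact Finset.sum_congr rfl hd'
      obtain ⟨j₀, hj₀⟩ := hne
      have hpos : e j₀ + 1 ≤ ∑ j ∈ s, (e j + 1) := Finset.single_le_sum (f := fun j => e j + 1) (fun j _ => Nat.zero_le _) hj₀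
      have hd₂ : (∏ j ∈ s, f j).natDegree = (∑ j ∈ s, (e j + 1) - 1) + 1 := by rw [hdeg]; omega
      have hcop : IsCoprime (f i) (∏ j ∈ s, f j) :=
        IsCoprime.prod_right fun j hj => hc (Finset.mem_coe.2 (Finset.mem_insert_self i s)) (Finset.mem_coe.2 (Finset.mem_insert_of_mem hj)) fun h => hi (h ▸ hj)
      rw [sigPos_hankelSq_dualSeq_mul_derivative_of_isCoprime hfi hm₂ hcop hdi hd₂ (by omega) a, ih hf' hd' hc' (by omega)]

/-- **Negative index: `sigNeg H_t(a(∏ᵢ fᵢ)′/∏ᵢ fᵢ) = Σ_{i ∈ s} sigNeg H_{eᵢ}(a fᵢ′/fᵢ)`** (same hypotheses). [this file, §726] -/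
theorem sigNeg_hankelSq_dualSeq_finset_prod_mul_derivative {ι : Type*} [DecidableEq ι] (s : Finset ι) {f : ι → K[X]} {e : ι → ℕ} (hf : ∀ i ∈ s, (f i).Monic) (hd : ∀ i ∈ s, (f i).natDegree = e i + 1)
    (hc : (s : Set ι).Pairwise (fun i j => IsCoprime (f i) (f j))) {t : ℕ} (ht : ∑ i ∈ s, (e i + 1) ≤ t + 1) (a : K[X]) :
    sigNeg (hankelSq K t (dualSeq K (∏ i ∈ s, f i) (a * derivative (∏ i ∈ s, f i)))).toQuadraticForm' = ∑ i ∈ s, sigNeg (hankelSq K (e i) (dualSeq K (f i) (a * derivative (f i)))).toQuadraticForm' := by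
  induction s using Finset.induction_on generalizing t with
  | empty => rw [Finset.prod_empty, Finset.sum_empty]; exact (sigPos_sigNeg_hankelSq_dualSeq_one t a).2
  | insert i s hi ih =>
    have hfi := hf i (Finset.mem_insert_self i s)
    have hdi := hd i (Finset.mem_insert_self i s)
    have hf' : ∀ j ∈ s, (f j).Monic := fun j hj => hf j (Finset.mem_insert_of_mem hj)
    have hd' : ∀ j ∈ s, (f j).natDegree = e j + 1 := fun j hj => hd j (Finset.mem_insert_of_mem hj)
    have hc' : (s : Set ι).Pairwise (fun i j => IsCoprime (f i) (f j)) := hc.mono (Finset.coe_subset.2 (Finset.subset_insert i s))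
    rw [Finset.sum_insert hi] at ht
    rw [Finset.prod_insert hi, Finset.sum_insert hi]
    rcases s.eq_empty_or_nonempty with rfl | hne
    · rw [Finset.prod_empty, mul_one, Finset.sum_empty, add_zero]
      rw [Finset.sum_empty, add_zero] at ht
      exact sigNeg_hankelSq_dualSeq_eq_of_natDegree_le hfi hdi ht _
    · have hm₂ : (∏ j ∈ s, f j).Monic := Polynomial.monic_prod_of_monic _ _ hf'
      have hdeg : (∏ j ∈ s, f j).natDegree = ∑ j ∈ s, (e j + 1) := by
        rw [Polynomial.natDegree_prod_of_monic _ _ hf']; exact Finset.sum_congr rfl hd'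
      obtain ⟨j₀, hj₀⟩ := hne
      have hpos : e j₀ + 1 ≤ ∑ j ∈ s, (e j + 1) := Finset.single_le_sum (f := fun j => e j + 1) (fun j _ => Nat.zero_le _) hj₀
      have hd₂ : (∏ j ∈ s, f j).natDegree = (∑ j ∈ s, (e j + 1) - 1) + 1 := by rw [hdeg]; omega
      have hcop : IsCoprime (f i) (∏ j ∈ s, f j) :=
        IsCoprime.prod_right fun j hj => hc (Finset.mem_coe.2 (Finset.mem_insert_self i s)) (Finset.mem_coe.2 (Finset.mem_insert_of_mem hj)) fun h => hi (h ▸ hj)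
      rw [sigNeg_hankelSq_dualSeq_mul_derivative_of_isCoprime hfi hm₂ hcop hdi hd₂ (by omega) a, ih hf' hd' hc' (by omega)]

/-- **Rank: `rank H_t(a(∏ᵢ fᵢ)′/∏ᵢ fᵢ) = Σ_{i ∈ s} rank H_{eᵢ}(a fᵢ′/fᵢ)`** over an ordered field (N132). [this file, §726] -/
theorem rank_hankelSq_dualSeq_finset_prod_mul_derivative {ι : Type*} [DecidableEq ι] (s : Finset ι) {f : ι → K[X]} {e : ι → ℕ} (hf : ∀ i ∈ s, (f i).Monic) (hd : ∀ i ∈ s, (f i).natDegree = e i + 1)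
    (hc : (s : Set ι).Pairwise (fun i j => IsCoprime (f i) (f j))) {t : ℕ} (ht : ∑ i ∈ s, (e i + 1) ≤ t + 1) (a : K[X]) :
    (hankelSq K t (dualSeq K (∏ i ∈ s, f i) (a * derivative (∏ i ∈ s, f i)))).rank = ∑ i ∈ s, (hankelSq K (e i) (dualSeq K (f i) (a * derivative (f i)))).rank := by
  rw [rank_hankelSq_eq_sigPos_add_sigNeg, sigPos_hankelSq_dualSeq_finset_prod_mul_derivative s hf hd hc ht a, sigNeg_hankelSq_dualSeq_finset_prod_mul_derivative s hf hd hc ht a, ← Finset.sum_add_distrib]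
  exact Finset.sum_congr rfl fun i _ => (rank_hankelSq_eq_sigPos_add_sigNeg (e i) _).symm

/-- **Signature: `Sign H_t(a(∏ f)′/∏ f) = Σᵢ Sign H_{eᵢ}(a fᵢ′/fᵢ)`** (as integers). [this file, §726] -/
theorem sigPos_sub_sigNeg_hankelSq_dualSeq_finset_prod_mul_derivative {ι : Type*} [DecidableEq ι] (s : Finset ι) {f : ι → K[X]} {e : ι → ℕ} (hf : ∀ i ∈ s, (f i).Monic) (hd : ∀ i ∈ s, (f i).natDegree = e i + 1)
    (hc : (s : Set ι).Pairwise (fun i j => IsCoprime (f i) (f j))) {t : ℕ} (ht : ∑ i ∈ s, (e i + 1) ≤ t + 1) (a : K[X]) :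
    (sigPos (hankelSq K t (dualSeq K (∏ i ∈ s, f i) (a * derivative (∏ i ∈ s, f i)))).toQuadraticForm' : ℤ) - sigNeg (hankelSq K t (dualSeq K (∏ i ∈ s, f i) (a * derivative (∏ i ∈ s, f i)))).toQuadraticForm'
      = ∑ i ∈ s, ((sigPos (hankelSq K (e i) (dualSeq K (f i) (a * derivative (f i)))).toQuadraticForm' : ℤ) - sigNeg (hankelSq K (e i) (dualSeq K (f i) (a * derivative (f i)))).toQuadraticForm') := by
  rw [sigPos_hankelSq_dualSeq_finset_prod_mul_derivative s hf hd hc ht a, sigNeg_hankelSq_dualSeq_finset_prod_mul_derivative s hf hd hc ht a, Nat.cast_sum, Nat.cast_sum, ← Finset.sum_sub_distrib]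

end Ordered

/-! ## §727. A split coprime factor peels off: its roots are counted with the sign of `a`, the cofactor keeps its Hermite form -/

section Split

variable {K} [LinearOrder K] [IsStrictOrderedRing K] [DecidableEq K]

/-- **`m₁` SPLIT, `m₂` any monic coprime cofactor: `sigPos H_t(a(m₁m₂)′/(m₁m₂)) = #{λ ∈ roots(m₁) | a(λ) > 0} + sigPos H_{e₂}(a m₂′/m₂)` and `sigNeg = #{λ ∈ roots(m₁) | a(λ) < 0} + sigNeg H_{e₂}(a m₂′/m₂)`**
(N136 additivity + N127 Hermite–Sylvester on the split factor; `deg mᵢ = eᵢ + 1`, `t + 1 ≥ deg(m₁m₂)`). [this file, §727] -/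
theorem sigPos_sigNeg_hankelSq_dualSeq_mul_derivative_of_splits_of_isCoprime {e₁ e₂ t : ℕ} {m₁ m₂ : K[X]} (hm₁ : m₁.Monic) (hs₁ : m₁.Splits) (hm₂ : m₂.Monic) (hc : IsCoprime m₁ m₂)
    (hd₁ : m₁.natDegree = e₁ + 1) (hd₂ : m₂.natDegree = e₂ + 1) (ht : e₁ + e₂ + 2 ≤ t + 1) (a : K[X]) :
    sigPos (hankelSq K t (dualSeq K (m₁ * m₂) (a * derivative (m₁ * m₂)))).toQuadraticForm'
        = (m₁.roots.toFinset.filter fun c => 0 < a.eval c).card + sigPos (hankelSq K e₂ (dualSeq K m₂ (a * derivative m₂))).toQuadraticForm'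
      ∧ sigNeg (hankelSq K t (dualSeq K (m₁ * m₂) (a * derivative (m₁ * m₂)))).toQuadraticForm'
        = (m₁.roots.toFinset.filter fun c => a.eval c < 0).card + sigNeg (hankelSq K e₂ (dualSeq K m₂ (a * derivative m₂))).toQuadraticForm' := by
  rw [sigPos_hankelSq_dualSeq_mul_derivative_of_isCoprime hm₁ hm₂ hc hd₁ hd₂ ht, sigNeg_hankelSq_dualSeq_mul_derivative_of_isCoprime hm₁ hm₂ hc hd₁ hd₂ ht,
    sigPos_hankelSq_dualSeq_mul_derivative hm₁ hs₁ hd₁.le, sigNeg_hankelSq_dualSeq_mul_derivative hm₁ hs₁ hd₁.le]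
  exact ⟨rfl, rfl⟩

/-- **The unweighted form: for `m₁` split and `m₂` a coprime monic cofactor, `sigPos H_t((m₁m₂)′/(m₁m₂)) = #roots(m₁) + sigPos H_{e₂}(m₂′/m₂)` and `sigNeg H_t((m₁m₂)′/(m₁m₂)) = sigNeg H_{e₂}(m₂′/m₂)`** —
the split part contributes its number of distinct roots and NO negative square; all negative squares come from the cofactor (over `ℝ`: from its pairs of conjugate roots, N128). [this file, §727] -/
theorem sigPos_sigNeg_hankelSq_dualSeq_derivative_of_splits_of_isCoprime {e₁ e₂ t : ℕ} {m₁ m₂ : K[X]} (hm₁ : m₁.Monic) (hs₁ : m₁.Splits) (hm₂ : m₂.Monic) (hc : IsCoprime m₁ m₂)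
    (hd₁ : m₁.natDegree = e₁ + 1) (hd₂ : m₂.natDegree = e₂ + 1) (ht : e₁ + e₂ + 2 ≤ t + 1) :
    sigPos (hankelSq K t (dualSeq K (m₁ * m₂) (derivative (m₁ * m₂)))).toQuadraticForm' = m₁.roots.toFinset.card + sigPos (hankelSq K e₂ (dualSeq K m₂ (derivative m₂))).toQuadraticForm'
      ∧ sigNeg (hankelSq K t (dualSeq K (m₁ * m₂) (derivative (m₁ * m₂)))).toQuadraticForm' = sigNeg (hankelSq K e₂ (dualSeq K m₂ (derivative m₂))).toQuadraticForm' := by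
  obtain ⟨h1, h2⟩ := sigPos_sigNeg_hankelSq_dualSeq_derivative_of_isCoprime hm₁ hm₂ hc hd₁ hd₂ ht
  obtain ⟨hp, hn⟩ := sigPos_hankelSq_dualSeq_derivative hm₁ hs₁ hd₁.le
  rw [h1, h2, hp, hn, zero_add]
  exact ⟨rfl, rfl⟩

/-- **Both factors split (e.g. `K` real closed and `m₁m₂` real-rooted): `sigPos H_t(a(m₁m₂)′/(m₁m₂)) = #{λ ∈ roots m₁ | a > 0} + #{λ ∈ roots m₂ | a > 0}`** — consistent with N127 applied to the (split)
product, whose distinct roots are the disjoint union by coprimality; recorded as the sanity check of the additivity. [this file, §727] -/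
theorem sigPos_hankelSq_dualSeq_mul_derivative_of_splits_of_splits {e₁ e₂ t : ℕ} {m₁ m₂ : K[X]} (hm₁ : m₁.Monic) (hs₁ : m₁.Splits) (hm₂ : m₂.Monic) (hs₂ : m₂.Splits) (hc : IsCoprime m₁ m₂)
    (hd₁ : m₁.natDegree = e₁ + 1) (hd₂ : m₂.natDegree = e₂ + 1) (ht : e₁ + e₂ + 2 ≤ t + 1) (a : K[X]) :
    sigPos (hankelSq K t (dualSeq K (m₁ * m₂) (a * derivative (m₁ * m₂)))).toQuadraticForm'
      = (m₁.roots.toFinset.filter fun c => 0 < a.eval c).card + (m₂.roots.toFinset.filter fun c => 0 < a.eval c).card := by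
  rw [(sigPos_sigNeg_hankelSq_dualSeq_mul_derivative_of_splits_of_isCoprime hm₁ hs₁ hm₂ hc hd₁ hd₂ ht a).1, sigPos_hankelSq_dualSeq_mul_derivative hm₂ hs₂ hd₂.le]

end Split

end Summit.Ventures.HSemireg.Wedge.HankelOuter
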